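import Mathlib
import Summits.MatrixMultiplication.MatrixMultiplication.Theses.FourierTwoFamiliesModP

/-!
# The light/heavy-sharing dichotomy for `PrimeCyclicPowerGain` (stmt-MatrixMultiplication-14309)

Route `FourierTwoFamiliesModP`, item `PrimeCyclicPowerGain` (a fixed power saving `n · s^{1+c} ≤ p` for balanced
SDPP configurations in `ℤ/pℤ`).  This file records, as theorems, the elementary bookkeeping that isolates the
open part of the item.

For a family of pairs `(A i, B i)_{i<n}` of finite subsets of an additive group write
`D(d) := Σ_j #{r ∈ A j ×ˢ B j : r.1 - r.2 = d}` for the *sharing multiplicity* of a difference `d` (under clause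
(W) this is the number of blocks `j` with `d ∈ A j - B j`).  The matched pairs `(a, b) ∈ A i ×ˢ B i` number
`n s²` in a balanced family, and grouping them by their difference gives the **multiplicity wall**
`n s² = Σ_d D(d) ≤ L · |H|` whenever `D ≤ L` pointwise (`card_mul_sq_le_of_mult_le`), and more generally the
**light-mass bound**: the matched pairs whose difference has multiplicity `≤ τ` number at most `τ · |H|`
(`lightMass_le`).  Consequently (`stub_heavyCoreReduction`, registered as a stub of the item) the item FOLLOWS from its restriction to the
*heavy-sharing core*: configurations in which more than half of the `n s²` matched pairs have a difference shared by
more than `s^{1-c}/4` blocks (if instead half the mass is light, `n s² / 2 ≤ (s^{1-c}/4) · p`, i.e.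
`n s^{1+c} ≤ p / 2`).  All known dense designs (translates, CRT cubes, radix digit boxes — see
`Cruxes/PrimeCyclicPowerGain/Disproof.lean`) are equidifferent (`A j - B j` independent of `j`, `D ≡ n` on it), so
they lie in the core; nothing here bears on the core itself, which is the open problem.

No definitions are introduced: multiplicities and masses are inlined sums, in the style of
`Theorems/FourierTwoFamiliesModPPrimeDensityDecayStubLowCollisionDecay.lean`.
-/

-- `Summit.<Summit>.<Problem>` coincide for this single-problem summit: the duplicate is deliberate.
set_option linter.dupNamespace false

namespace Summit.MatrixMultiplication.MatrixMultiplication.Theorems.PrimeCyclicPowerGainHeavyCore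

open scoped BigOperators Pointwise

variable {H : Type*} [AddCommGroup H] [DecidableEq H] {n : ℕ}

/-- Fibrewise count of a filtered set of pairs over the difference map: the pairs `q ∈ S` with `P (q.1 - q.2)`
are counted difference by difference. -/
theorem card_filter_eq_sum_fiber [Fintype H] (S : Finset (H × H)) (P : H → Prop) [DecidablePred P] :
    (S.filter fun q => P (q.1 - q.2)).card =
      ∑ d : H, if P d then (S.filter fun q => q.1 - q.2 = d).card else 0 := by
  rw [Finset.card_eq_sum_card_fiberwise (f := fun q : H × H => q.1 - q.2) (t := Finset.univ)
    (fun q _ => Finset.mem_univ _)]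
  refine Finset.sum_congr rfl fun d _ => ?_
  split_ifs with hd
  · congr 1
    ext q
    simp only [Finset.mem_filter]
    constructor
    · rintro ⟨⟨hq, -⟩, hqd⟩
      exact ⟨hq, hqd⟩
    · rintro ⟨hq, hqd⟩
      exact ⟨⟨hq, hqd ▸ hd⟩, hqd⟩
  · rw [Finset.card_eq_zero, Finset.filter_eq_empty_iff]
    rintro q hq
    rw [Finset.mem_filter] at hq
    intro hqd
    exact hd (hqd ▸ hq.2)

/-- **Light-mass bound.**  For any family of pairs and any threshold `τ ≥ 0`, the matched pairs
`(a, b) ∈ A i ×ˢ B i` whose difference `a - b` has sharing multiplicity `D(a - b) ≤ τ` number at most `τ · |H|`: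
grouped by their difference `d` they contribute `D(d) ≤ τ` for each light `d`. -/
theorem lightMass_le [Fintype H] (A B : Fin n → Finset H) {τ : ℝ} (hτ : 0 ≤ τ) :
    ((∑ i, ((A i ×ˢ B i).filter fun q : H × H =>
        ((∑ j, ((A j ×ˢ B j).filter fun r : H × H => r.1 - r.2 = q.1 - q.2).card : ℕ) : ℝ) ≤ τ).card : ℕ) : ℝ)
      ≤ τ * Fintype.card H := by
  -- count fibrewise over the difference and swap the sums
  have hfib : ∀ i : Fin n,
      ((A i ×ˢ B i).filter fun q : H × H =>
          ((∑ j, ((A j ×ˢ B j).filter fun r : H × H => r.1 - r.2 = q.1 - q.2).card : ℕ) : ℝ) ≤ τ).card =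
        ∑ d : H, if ((∑ j, ((A j ×ˢ B j).filter fun r : H × H => r.1 - r.2 = d).card : ℕ) : ℝ) ≤ τ then
          ((A i ×ˢ B i).filter fun q : H × H => q.1 - q.2 = d).card else 0 :=
    fun i => card_filter_eq_sum_fiber (A i ×ˢ B i)
      (fun d => ((∑ j, ((A j ×ˢ B j).filter fun r : H × H => r.1 - r.2 = d).card : ℕ) : ℝ) ≤ τ)
  simp_rw [hfib]
  rw [Finset.sum_comm]
  -- each difference contributes at most `τ`
  have hterm : ∀ d : H,
      ((∑ i : Fin n, (if ((∑ j, ((A j ×ˢ B j).filter fun r : H × H => r.1 - r.2 = d).card : ℕ) : ℝ) ≤ τ then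
          ((A i ×ˢ B i).filter fun q : H × H => q.1 - q.2 = d).card else 0) : ℕ) : ℝ) ≤ τ := by
    intro d
    split_ifs with hd
    · exact hd
    · simp only [Finset.sum_const_zero, Nat.cast_zero]
      exact hτ
  calc ((∑ d : H, ∑ i : Fin n,
          (if ((∑ j, ((A j ×ˢ B j).filter fun r : H × H => r.1 - r.2 = d).card : ℕ) : ℝ) ≤ τ then
            ((A i ×ˢ B i).filter fun q : H × H => q.1 - q.2 = d).card else 0) : ℕ) : ℝ)
        = ∑ d : H, ((∑ i : Fin n,
          (if ((∑ j, ((A j ×ˢ B j).filter fun r : H × H => r.1 - r.2 = d).card : ℕ) : ℝ) ≤ τ then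
            ((A i ×ˢ B i).filter fun q : H × H => q.1 - q.2 = d).card else 0) : ℕ) : ℝ) := by
          push_cast
          rfl
    _ ≤ ∑ _d : H, τ := Finset.sum_le_sum fun d _ => hterm d
    _ = τ * Fintype.card H := by
          rw [Finset.sum_const, Finset.card_univ, nsmul_eq_mul, mul_comm]

/-- **Multiplicity wall.**  If every difference has sharing multiplicity `D(d) ≤ L`, then a family of pairs of
`s`-sets has `n · s² ≤ L · |H|`: the `n s²` matched pairs, grouped by difference, are `Σ_d D(d) ≤ L |H|`.
(With `L` the maximal multiplicity this is the elementary reason why the item is open only for heavily shared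
matched differences: `L ≤ s^{1-c}` already gives `n s^{1+c} ≤ |H|`.) -/
theorem card_mul_sq_le_of_mult_le [Fintype H] {s L : ℕ} (A B : Fin n → Finset H)
    (hcard : ∀ i : Fin n, (A i).card = s ∧ (B i).card = s)
    (hmult : ∀ d : H, (∑ j, ((A j ×ˢ B j).filter fun r : H × H => r.1 - r.2 = d).card) ≤ L) :
    n * s ^ 2 ≤ L * Fintype.card H := by
  -- total mass, counted fibrewise
  have htot : ∑ i : Fin n, (A i ×ˢ B i).card = n * s ^ 2 := by
    have : ∀ i : Fin n, (A i ×ˢ B i).card = s ^ 2 := fun i => by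
      rw [Finset.card_product, (hcard i).1, (hcard i).2, sq]
    simp_rw [this]
    rw [Finset.sum_const, Finset.card_univ, Fintype.card_fin, smul_eq_mul]
  have hfib : ∀ i : Fin n, (A i ×ˢ B i).card =
      ∑ d : H, ((A i ×ˢ B i).filter fun q : H × H => q.1 - q.2 = d).card := fun i =>
    Finset.card_eq_sum_card_fiberwise (f := fun q : H × H => q.1 - q.2) (t := Finset.univ)
      (fun q _ => Finset.mem_univ _)
  rw [← htot]
  simp_rw [hfib]
  rw [Finset.sum_comm]
  calc ∑ d : H, ∑ i : Fin n, ((A i ×ˢ B i).filter fun q : H × H => q.1 - q.2 = d).card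
      ≤ ∑ _d : H, L := Finset.sum_le_sum fun d _ => hmult d
    _ = L * Fintype.card H := by rw [Finset.sum_const, Finset.card_univ, smul_eq_mul, mul_comm]

/-- **The item follows from its heavy-sharing core.**  Suppose that for some `c > 0` and `s₀` every balanced SDPP
configuration in `ℤ/pℤ` with `s ≥ s₀` in which MORE THAN HALF of the `n s²` matched pairs `(a, b) ∈ A i ×ˢ B i` have a
difference of sharing multiplicity `D(a - b) > s^{1-c}/4` satisfies `n · s^{1+c} ≤ p`.  Then `PrimeCyclicPowerGain`
holds (with the same `c`): in the remaining configurations at least half of the matched mass is light, and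
`lightMass_le` with `τ = s^{1-c}/4` gives `n s² / 2 ≤ s^{1-c} p / 4`, i.e. `n s^{1+c} ≤ p / 2`. -/
theorem stub_heavyCoreReduction :
    (∃ c : ℝ, 0 < c ∧ ∃ s₀ : ℕ, ∀ p : ℕ, p.Prime → ∀ (n s : ℕ) (A B : Fin n → Finset (ZMod p)),
      s₀ ≤ s → (∀ i : Fin n, (A i).card = s ∧ (B i).card = s) →
      (∀ i : Fin n, ∀ a ∈ A i, ∀ a' ∈ A i, ∀ b ∈ B i, ∀ b' ∈ B i, (a - a') + (b - b') = 0 → a = a' ∧ b = b') →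
      (∀ i j k : Fin n, ∀ a ∈ A i, ∀ a' ∈ A j, ∀ b ∈ B j, ∀ b' ∈ B k, (a - a') + (b - b') = 0 → i = k) →
      (n : ℝ) * (s : ℝ) ^ 2 < 2 * ((∑ i, ((A i ×ˢ B i).filter fun q : ZMod p × ZMod p =>
          (s : ℝ) ^ (1 - c) <
            4 * ((∑ j, ((A j ×ˢ B j).filter fun r : ZMod p × ZMod p => r.1 - r.2 = q.1 - q.2).card : ℕ) : ℝ)).card
              : ℕ) : ℝ) →
      (n : ℝ) * (s : ℝ) ^ (1 + c) ≤ (p : ℝ)) →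
    Summit.MatrixMultiplication.MatrixMultiplication.Theses.FourierTwoFamiliesModP.PrimeCyclicPowerGain := by
  intro hcore
  unfold Summit.MatrixMultiplication.MatrixMultiplication.Theses.FourierTwoFamiliesModP.PrimeCyclicPowerGain
  obtain ⟨c, hc, s₀, hcore⟩ := hcore
  refine ⟨c, hc, max s₀ 1, ?_⟩
  intro p hp n s A B hs hcard hW hX
  haveI : Fact p.Prime := ⟨hp⟩
  have hs₀ : s₀ ≤ s := le_trans (le_max_left _ _) hs
  have hs1 : 1 ≤ s := le_trans (le_max_right _ _) hs
  have hspos : (0 : ℝ) < s := by exact_mod_cast hs1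
  by_cases hheavy : (n : ℝ) * (s : ℝ) ^ 2 < 2 * ((∑ i, ((A i ×ˢ B i).filter fun q : ZMod p × ZMod p =>
      (s : ℝ) ^ (1 - c) <
        4 * ((∑ j, ((A j ×ˢ B j).filter fun r : ZMod p × ZMod p => r.1 - r.2 = q.1 - q.2).card : ℕ) : ℝ)).card
          : ℕ) : ℝ)
  · exact hcore p hp n s A B hs₀ hcard hW hX hheavy
  · -- the light half of the mass
    push Not at hheavy
    set τ : ℝ := (s : ℝ) ^ (1 - c) / 4 with hτ
    have hτ0 : 0 ≤ τ := by positivity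
    -- light + heavy = n s²
    have hsplit : ∀ i : Fin n,
        ((A i ×ˢ B i).filter fun q : ZMod p × ZMod p =>
            ((∑ j, ((A j ×ˢ B j).filter fun r : ZMod p × ZMod p => r.1 - r.2 = q.1 - q.2).card : ℕ) : ℝ) ≤ τ).card +
          ((A i ×ˢ B i).filter fun q : ZMod p × ZMod p =>
            (s : ℝ) ^ (1 - c) <
              4 * ((∑ j, ((A j ×ˢ B j).filter fun r : ZMod p × ZMod p => r.1 - r.2 = q.1 - q.2).card : ℕ) : ℝ)).card
          = s ^ 2 := by
      intro i
      have h := Finset.card_filter_add_card_filter_not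
        (s := A i ×ˢ B i) (fun q : ZMod p × ZMod p =>
          ((∑ j, ((A j ×ˢ B j).filter fun r : ZMod p × ZMod p => r.1 - r.2 = q.1 - q.2).card : ℕ) : ℝ) ≤ τ)
      rw [Finset.card_product, (hcard i).1, (hcard i).2, ← sq] at h
      rw [← h]
      congr 2
      ext q
      simp only [Finset.mem_filter, not_le, hτ]
      constructor
      · rintro ⟨hq, hlt⟩
        exact ⟨hq, by linarith⟩
      · rintro ⟨hq, hlt⟩
        exact ⟨hq, by linarith⟩
    have hmass : ((∑ i, ((A i ×ˢ B i).filter fun q : ZMod p × ZMod p =>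
            ((∑ j, ((A j ×ˢ B j).filter fun r : ZMod p × ZMod p => r.1 - r.2 = q.1 - q.2).card : ℕ) : ℝ) ≤ τ).card
              : ℕ) : ℝ) +
          ((∑ i, ((A i ×ˢ B i).filter fun q : ZMod p × ZMod p =>
            (s : ℝ) ^ (1 - c) <
              4 * ((∑ j, ((A j ×ˢ B j).filter fun r : ZMod p × ZMod p => r.1 - r.2 = q.1 - q.2).card : ℕ) : ℝ)).card
              : ℕ) : ℝ)
          = (n : ℝ) * (s : ℝ) ^ 2 := by
      rw [← Nat.cast_add, ← Finset.sum_add_distrib]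
      simp_rw [hsplit]
      rw [Finset.sum_const, Finset.card_univ, Fintype.card_fin, smul_eq_mul]
      push_cast
      ring
    -- the light mass is at most `τ p`
    have hlight := lightMass_le (H := ZMod p) A B hτ0
    rw [ZMod.card] at hlight
    -- so `n s² ≤ 2 τ p = s^{1-c} p / 2`
    have hkey : (n : ℝ) * (s : ℝ) ^ 2 ≤ (s : ℝ) ^ (1 - c) * p / 2 := by
      have : (n : ℝ) * (s : ℝ) ^ 2 ≤ 2 * (τ * p) := by linarith
      rw [hτ] at this
      linarith
    -- divide by `s^{1-c}`: `s² = s^{1+c} · s^{1-c}`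
    have hpow : (s : ℝ) ^ 2 = (s : ℝ) ^ (1 + c) * (s : ℝ) ^ (1 - c) := by
      rw [← Real.rpow_add hspos]
      norm_num
    have hs1c : (0 : ℝ) < (s : ℝ) ^ (1 - c) := Real.rpow_pos_of_pos hspos _
    have hppos : (0 : ℝ) ≤ p := Nat.cast_nonneg p
    rw [hpow, ← mul_assoc] at hkey
    have h2 : (n : ℝ) * (s : ℝ) ^ (1 + c) ≤ p / 2 := by
      have := div_le_div_of_nonneg_right hkey hs1c.le
      rw [mul_div_assoc, div_self hs1c.ne', mul_one] at this
      calc (n : ℝ) * (s : ℝ) ^ (1 + c) ≤ (s : ℝ) ^ (1 - c) * p / 2 / (s : ℝ) ^ (1 - c) := this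
        _ = p / 2 := by field_simp
    linarith

end Summit.MatrixMultiplication.MatrixMultiplication.Theorems.PrimeCyclicPowerGainHeavyCore
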